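import Summits.QuantumFields.YangMills.Theorems.UnitScaleTiltProp7OneFormGreenBlockDivergenceLetters
import Summits.QuantumFields.YangMills.Theorems.UnitScaleTiltProp7PoissonGradientDecay
import Summits.QuantumFields.YangMills.Theorems.UnitScaleTiltProp7OneFormGradientSup
import HarnessLib

/-!
# Route `UnitScaleTilt`, crux K1 «MinimiserStabilityRegPr» (stmt-QuantumFields-19200), EX face, norm_G ∕ h133 road — N6 FILE D letter (dκ), part 3 of 3:
# **(dκ) «N5-blk»: THE DECAYED COVARIANT-DIVERGENCE ROW OF `G₀` ON A BLOCK-SUPPORTED SOURCE** — `‖(toL2S⁻¹(D*_{U₀}(G₀(toL2 X))))(x)‖ ≤ s·C_D·e^{−κ₁·tdist(B x, z)}`, `κ₁ = min r ¼ ∕ 2`,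
# for `X` supported on the bonds of the block `z` with `‖X b‖ ≤ s` — ★p1 g27 CHAIR WORD №30 (2) «(dκ) «N5-blk» = the decayed covariant-DIVERGENCE row of `G₀` on a block-supported source … T1 is
# local, so it follows from ✓p768545 §3 + ✓p767711∕✓p768169»; px5 g13 10:35:44Z «the OF-GRAD assembly re-run with LOCAL sups of `G₀X`»; px16 g13 10:39:50Z «GO — (dκ) IS YOURS».
# (width seat `ym3-torus-px21` g15)

Cell `ym3-torus` (HUMAN RULING D-0037; rung R3 = SU(2) YM₃ on T³ — NOT d = 4, NOT infinite volume, NOT a mass gap, NOT Clay).  THEOREMS ONLY (0 `def`, 0 `sorry`, default heartbeats);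
`--supports stmt-QuantumFields-19200 --as helper`; count-neutral.

THE ROAD ([Balaban1985BackgroundPropagators] Thm 3.1 (3.42)–(3.44): «the estimates for `∇G`, `G∇*` follow from the local regularity estimates (3.45)–(3.47) and the exponential decay»).
`D*_{U₀}(G₀X)(x)` is the sum of three transported covariant GRADIENTS of the components `u_ν := toL2S (G₀X)_ν` one site back (part 2 §1 — no `η⁻¹`); each `u_ν` solves the SITE covariant
Poisson equation `Δ^η_{U₀}u_ν + q_ν = D*0` (px5 ✓`Prop7OneFormGradientSup.covLapSite_formComp_add_eq`, O1 (134)–(135)) whose data DECAY off the source block: `u_ν` by the decayed VALUE row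
(px16 ✓`norm_symm_GT_apply_le_of_blockSupport`, displayed here as the letter `hval`), `q_ν` by part 2 (local pair §2, (D)∕(Q) words §3 through the `h349`∕`hk_Q` kernel rows and the block-`L²`
decay, source component by support); hence by part 1 ✓`Prop7PoissonGradientDecay.gradient_decay_of_decay'` (T1-core localised ∘ px12's weighted absorption) every `D_{U₀}u_ν` decays, and
part 2 §4 sums the three.
WHAT IS PROVED (ns `Summit.QuantumFields.YangMills.Theorems.Prop7OneFormGreenBlockDivergence`).
* §1 `formComp_decay_of_val` · `remainder_decay_of_rows` (the component data from the four decayed rows; the slot term VANISHES at `DeltaEtaSlot`) ·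
  ★★ `componentGradient_decay_of_rows` (every component's covariant gradient decays: part 1 fed with the two).
* §2 ★★★ `norm_symm_DstarL2_GT_le_of_blockSupport` — THE LETTER (dκ): at N4 §2's letters VERBATIM (`RegPr`, `0 < ε₀ ≤ 1`, `PosOnto`, (γ) `hco`, (C_V) `hVlow`, (θ_V-class) `hVconj`,
  `0 < Θ`, `hkD`, `hkQ`, `r < μ′`) + the decayed value row `hval` (px16 §3's CONCLUSION, free constant `A_V`, no sign hypothesis) + the no-wrap room + the gradient margin `C_g·48ε₀(6√2√10+6√2)·e^{51κ₁} ≤ ½`: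
  `‖(toL2S⁻¹(D*_{U₀}(G₀(toL2 X))))(x)‖ ≤ s·C_D·e^{−κ₁·tdist(B x, z)}` with the explicit `C_D(C_g, C, ε₀, r, A_V, C_kD, C_kQ, μ′, γ, C_V, θ_V, ε, c₀, d, ℓ)` printed in the statement.
K-BOOKKEEPING (for the knitter's numerics, cf. px16 `…OneFormGreenKFreeNumerics`): every `(L^d)^{K−n}` in `C_D` stands next to `C_kD`∕`C_kQ` (`ℓ⁻³`-class, chair №13) or inside `√(2c₀dℓ^d)`
(`= √6` at the pin `c₀ = ℓ⁻³`); `C_g`, `C` are the universal constants of ✓`exists_curved_localGradient` ∕ ✓`norm_bgOfCfg_axialT_sub_le` (`Exists.choose` of landed closed theorems).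
HYP-SAT (★★OWNER RULING №42).  Every displayed letter is a real-inequality schema or an operator identity inhabited in the tree at the member∕under `Lift` (N4 §2's by D1 ✓`kernelRow_GT_DeltaEtaSlot_of_lift`'s
10-line pattern ∕ A2h ∕ A2g ∕ ✓`hkQ_of_regPr` ∕ ✓`kernelRow349_allMembers_exists`; `hval` by px16 §3 ∕ ✓p768901; `hroom` CHAIR WORD №1 class; `hsmall` = smallness of `ε₀` vs the universal `C_g`, K-free
since `κ₁ ≤ ⅛`).  Conclusion non-vacuous; nothing conclusion-shaped is assumed.
HONEST SCOPE.  Composition of landed rows; CONDITIONAL on every displayed letter; nothing of FILE D, `norm_G`, `h133`, the EX rows, EX, 19200 or the rung is proved here; the Yang–Mills mass gap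
is NOT proved.

References: T. Bałaban, CMP **99** (1985) 389–434 [Balaban1985BackgroundPropagators] ((3.8) p.392, (3.11) p.392, (3.26)–(3.27) p.395, Thm 3.1 (3.42)–(3.47) pp.397–399, (3.49) p.399, Thm 3.12
p.422); CMP **102** (1985) 277–309 [Balaban1985Variational] ((19) p.281, (134)–(135) p.298); CMP **96** (1984) 223–250 [Balaban1984PropagatorsII] (Lemma 2.1 pp.227–228, (2.61)–(2.63) p.234).
-/

set_option autoImplicit false

noncomputable section

open scoped BigOperators Matrix.Norms.L2Operator InnerProductSpace ComplexConjugate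

namespace Summit.QuantumFields.YangMills.Theorems.Prop7OneFormGreenBlockDivergence

open Literature.MathematicalPhysics.QuantumFieldTheory.Balaban1983to89
open Literature.MathematicalPhysics.QuantumFieldTheory.Balaban1983to89.T3ContinuumYM3Torus
open Literature.MathematicalPhysics.QuantumFieldTheory.Balaban1983to89.T3PrintedRegularMinimiser (RegPr)
open T3SectALandauChart (formComp bgUnits covDerivFwdT covDivFormT eta eta_pos)
open B10Eq68TorusRegularity (covDerivT)
open B7Eq78Linearization (conjR conjR_apply conjR_sub conjR_smul_real)
open B7Prop1Explicit (U1)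
open B4Sect5Torus (TSite)
open B9SectCLatticeCarrier (Bond)
open B9TorusCalculus (torusT torusT_apply torusT_symm_apply)
open B9Eq310Hermitian (deltaPrimeOp)
open B11Eq135Weitzenbock (curvOp)
open B9Eq311L2Pairing (WL2)
open B11Eq103H1Complex (BondL2K SiteL2K)
open B5Eq118OneStroke (iterBlockOf)
open B3Taylor310LocalRemainder (tdist_comm tdist_triangle)
open Summit.QuantumFields.Balaban3D.Proofs.Run3Collar (tdist_shift_le)
open Summit.QuantumFields.YangMills.Theorems.Prop7SectET3Transport (periodsT3 siteEquiv bondEquiv)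
open Summit.QuantumFields.YangMills.Theorems.Prop7SectET3HilbertLetters (W₂ frobEquiv toL2 toL2S DL2 DstarL2 covLapSite toL2_apply toL2_symm_apply toL2S_apply)
open Summit.QuantumFields.YangMills.Theorems.Prop7LandauDict (DL2_toL2S_eq_covDerivFwdT DstarL2_toL2_eq_covDivFormT)
open Summit.QuantumFields.YangMills.Theorems.Prop7OneFormAgmonLocal (deltaPrimeOp_congr_of_agree curvOp_congr_of_agree tdist_le_two_of_stencil)
open Summit.QuantumFields.YangMills.Theorems.Prop7OneFormKatoForm (norm_local_remainder_le_of_regPr)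
open Summit.QuantumFields.YangMills.Theorems.Prop7SectET3WilsonHessian (DeltaEta DeltaEtaSlot)
open Summit.QuantumFields.YangMills.Theorems.Prop7SectET3GaugeProjector (RS)
open Summit.QuantumFields.YangMills.Theorems.Prop7SectET3CurvedPropagators (laplaceA Qk GT PosOnto laplaceA_GT)
open Summit.QuantumFields.YangMills.Theorems.Prop7RieszTauFrobNorm (norm_frobEquiv_le norm_frobEquiv_symm_le)
open Summit.QuantumFields.YangMills.Theorems.Prop7OneFormGreenSupBound (norm_toL2_blockPiece_le)
open Summit.QuantumFields.YangMills.Theorems.Prop7OneFormBlockDecayAll (blockDecay_allBlocks_of_letters eta_sq_exp_sub_one_sq_le)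
open Summit.QuantumFields.YangMills.Theorems.Prop7OneFormRemainderDecay (norm_symm_apply_le_of_kernelRow_blockDecay)
open Summit.QuantumFields.YangMills.Theorems.Prop7OneFormDecayData (norm_le_mul_exp_neg_of_support)
open Summit.QuantumFields.YangMills.Theorems.Prop7CurvedMemberLocalGradient (exists_curved_localGradient)
open Summit.QuantumFields.YangMills.Theorems.AxialGaugeChartGlue (norm_bgOfCfg_axialT_sub_le)
open Summit.QuantumFields.YangMills.Theorems.Prop7OneFormGreenBlockDivergenceLetters (norm_local_pair_le_of_decay blockL2Decay_GT_of_letters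
  norm_word_le_of_kernelRow_blockDecay norm_symm_DstarL2_le_of_componentDecay)


variable (F : T3Family) {n K : ℕ} (c₀ : ℝ) [Fact (0 < c₀)] (U₀ : GaugeField (F.P K) 0 (Matrix.specialUnitaryGroup (Fin 2) ℂ))
  {h : n ≤ K} {cB a : ℝ} [Fact (0 < cB)]

/-! ## §1 The component data decay ⟹ the components' gradients decay -/

omit [Fact (0 < c₀)] [Fact (0 < cB)] in
/-- **THE COMPONENT SUPS FROM THE DECAYED VALUE ROW** (`√2`: Frobenius vs operator norm ✓`norm_frobEquiv_symm_le`). [cite: Balaban1985BackgroundPropagators, (3.11) p.392] -/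
theorem formComp_decay_of_val (W : PBond (F.P K) 0 → Matrix (Fin 2) (Fin 2) ℂ) (z : Site (F.P K) (K - n)) (κ : ℝ) {cV : ℝ}
    (hval : ∀ b : PBond (F.P K) 0, ‖W b‖ ≤ cV * Real.exp (-(κ * (Site.tdist (P := F.P K) (iterBlockOf (K - n) b.src) z : ℝ)))) (ν : Fin (F.P K).d) (x : Site (F.P K) 0) :
    ‖WL2.equiv ℂ (fun _ : TSite 3 (periodsT3 F K) => c₀) W₂ (toL2S F K c₀ (formComp W ν)) (siteEquiv F K x)‖ ≤ (Real.sqrt 2 * cV) * Real.exp (-(κ * (Site.tdist (P := F.P K) (iterBlockOf (K - n) x) z : ℝ))) := by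
  rw [toL2S_apply, Equiv.symm_apply_apply, mul_assoc]
  exact (norm_frobEquiv_symm_le _).trans (mul_le_mul_of_nonneg_left (hval ⟨x, ν⟩) (Real.sqrt_nonneg _))

/-- **THE COMPONENT REMAINDERS FROM THE FOUR DECAYED ROWS** (local pair, (D)-word, (Q)-word, source; the slot term VANISHES at `DeltaEtaSlot`): `‖q_ν(e x)‖ ≤ √2·(c_L + c_D + c_Q + c_S)·e^{−κ·d(B x, z)}`.
[cite: Balaban1985Variational, (134)–(135) p.298; Balaban1985BackgroundPropagators, (3.26)–(3.27) p.395] -/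
theorem remainder_decay_of_rows (W X : PBond (F.P K) 0 → Matrix (Fin 2) (Fin 2) ℂ) (z : Site (F.P K) (K - n)) (κ : ℝ) {cL cD cQ cS : ℝ}
    (hLoc : ∀ b : PBond (F.P K) 0, ‖(eta F n K)⁻¹ • (eta F n K)⁻¹ •
        (deltaPrimeOp (torusT (F.P K) 0) (fun μ x => bgUnits F K U₀ ⟨x, μ⟩) 1 (formComp W) b.dir b.src
          - curvOp (torusT (F.P K) 0) (fun μ x => bgUnits F K U₀ ⟨x, μ⟩) (formComp W) b.dir b.src)‖ ≤ cL * Real.exp (-(κ * (Site.tdist (P := F.P K) (iterBlockOf (K - n) b.src) z : ℝ))))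
    (hDw : ∀ b : PBond (F.P K) 0, ‖(toL2 F K c₀).symm (DL2 F n K c₀ U₀ (DstarL2 F n K c₀ U₀ (toL2 F K c₀ W) - RS F n K h c₀ cB U₀ (DstarL2 F n K c₀ U₀ (toL2 F K c₀ W)))) b‖ ≤ cD * Real.exp (-(κ * (Site.tdist (P := F.P K) (iterBlockOf (K - n) b.src) z : ℝ))))
    (hQw : ∀ b : PBond (F.P K) 0, ‖(toL2 F K c₀).symm (LinearMap.adjoint (Qk F n K h c₀ cB U₀) (((a : ℝ) : ℂ) • Qk F n K h c₀ cB U₀ (toL2 F K c₀ W))) b‖ ≤ cQ * Real.exp (-(κ * (Site.tdist (P := F.P K) (iterBlockOf (K - n) b.src) z : ℝ))))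
    (hSrc : ∀ b : PBond (F.P K) 0, ‖X b‖ ≤ cS * Real.exp (-(κ * (Site.tdist (P := F.P K) (iterBlockOf (K - n) b.src) z : ℝ)))) (ν : Fin (F.P K).d) (x : Site (F.P K) 0) :
    ‖WL2.equiv ℂ (fun _ : TSite 3 (periodsT3 F K) => c₀) W₂ (toL2S F K c₀ (fun x : Site (F.P K) 0 => (eta F n K)⁻¹ • (eta F n K)⁻¹ • (deltaPrimeOp (torusT (F.P K) 0) (fun μ x => bgUnits F K U₀ ⟨x, μ⟩) 1 (formComp W ) ν x - curvOp (torusT (F.P K) 0) (fun μ x => bgUnits F K U₀ ⟨x, μ⟩) (formComp W) ν x) + (toL2 F K c₀).symm ((DeltaEtaSlot F n K c₀ U₀ - (DeltaEta F n K c₀ U₀ : BondL2K ℂ 3 (periodsT3 F K) c₀ W₂ →ₗ[ℂ] BondL2K ℂ 3 (periodsT3 F K) c₀ W₂)) (toL2 F K c₀ W)) ⟨x, ν⟩ - (toL2 F K c₀).symm (DL2 F n K c₀ U₀ (DstarL2 F n K c₀ U₀ (toL2 F K c₀ W) - RS F n K h c₀ cB U₀ (DstarL2 F n K c₀ U₀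 (toL2 F K c₀ W)))) ⟨x, ν⟩ + (toL2 F K c₀).symm (LinearMap.adjoint (Qk F n K h c₀ cB U₀) (((a : ℝ) : ℂ) • Qk F n K h c₀ cB U₀ (toL2 F K c₀ W))) ⟨x, ν⟩) - toL2S F K c₀ (formComp X ν)) (siteEquiv F K x)‖
      ≤ (Real.sqrt 2 * (cL + cD + cQ + cS)) * Real.exp (-(κ * (Site.tdist (P := F.P K) (iterBlockOf (K - n) x) z : ℝ))) := by
  have hslot : (toL2 F K c₀).symm ((DeltaEtaSlot F n K c₀ U₀ - (DeltaEta F n K c₀ U₀ : BondL2K ℂ 3 (periodsT3 F K) c₀ W₂ →ₗ[ℂ] BondL2K ℂ 3 (periodsT3 F K) c₀ W₂)) (toL2 F K c₀ W)) ⟨x, ν⟩ = 0 := by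
    have h0 : DeltaEtaSlot F n K c₀ U₀ - (DeltaEta F n K c₀ U₀ : BondL2K ℂ 3 (periodsT3 F K) c₀ W₂ →ₗ[ℂ] BondL2K ℂ 3 (periodsT3 F K) c₀ W₂) = 0 := by
      rw [sub_eq_zero]; rfl
    rw [h0, LinearMap.zero_apply, map_zero, Pi.zero_apply]
  rw [WL2.equiv_sub, Pi.sub_apply, toL2S_apply, toL2S_apply, ← map_sub, Equiv.symm_apply_apply, hslot, add_zero]
  refine (norm_frobEquiv_symm_le _).trans ?_
  rw [mul_assoc]
  refine mul_le_mul_of_nonneg_left ?_ (Real.sqrt_nonneg _)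
  have e : ∀ (Lm Dm Qm Yv : Matrix (Fin 2) (Fin 2) ℂ), ‖Lm - Dm + Qm - Yv‖ ≤ ‖Lm‖ + ‖Dm‖ + ‖Qm‖ + ‖Yv‖ := by
    intro Lm Dm Qm Yv
    calc ‖Lm - Dm + Qm - Yv‖ ≤ ‖Lm - Dm + Qm‖ + ‖Yv‖ := norm_sub_le _ _
      _ ≤ ‖Lm - Dm‖ + ‖Qm‖ + ‖Yv‖ := by gcongr; exact norm_add_le _ _
      _ ≤ ‖Lm‖ + ‖Dm‖ + ‖Qm‖ + ‖Yv‖ := by gcongr; exact norm_sub_le _ _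
  refine (e _ _ _ _).trans ?_
  have h1 := hLoc ⟨x, ν⟩
  have h3 := hDw ⟨x, ν⟩
  have h4 := hQw ⟨x, ν⟩
  have h5 : ‖formComp X ν x‖ ≤ cS * Real.exp (-(κ * (Site.tdist (P := F.P K) (iterBlockOf (K - n) x) z : ℝ))) := hSrc ⟨x, ν⟩
  have hsum := add_le_add (add_le_add (add_le_add h1 h3) h4) h5
  refine hsum.trans (le_of_eq ?_)
  ring

/-- ★★ **THE COMPONENTS' COVARIANT GRADIENTS DECAY** — part 1 ✓`Prop7PoissonGradientDecay.gradient_decay_of_decay'` for `u_ν := toL2S(G₀X)_ν` (equation ✓`covLapSite_formComp_add_eq` at the slot of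
record) fed with the two lemmas above: `‖toL2⁻¹(D_{U₀}(toL2S (G₀X)_ν)) b‖ ≤ M(c_V, c_L + c_D + c_Q + c_S)·e^{−κ·d(B b₋, z)}`.
[cite: Balaban1985BackgroundPropagators, Thm 3.1 (3.42)–(3.44) pp.397–398; Balaban1985Variational, (19) p.281, (134)–(135) p.298] -/
theorem componentGradient_decay_of_rows {ε₀ : ℝ} (hε₀ : 0 < ε₀) (hε₀1 : ε₀ ≤ 1) (hreg : RegPr F n K ε₀ U₀)
    (hp : PosOnto F n K h c₀ cB a (DeltaEtaSlot F n K c₀) U₀) (X : PBond (F.P K) 0 → Matrix (Fin 2) (Fin 2) ℂ) (z : Site (F.P K) (K - n))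
    {κ : ℝ} (hκ : 0 ≤ κ) {cV cL cD cQ cS : ℝ} (hcV : 0 ≤ cV) (hcL : 0 ≤ cL) (hcD : 0 ≤ cD) (hcQ : 0 ≤ cQ) (hcS : 0 ≤ cS)
    (hval : ∀ b : PBond (F.P K) 0, ‖((toL2 F K c₀).symm (GT F n K h c₀ cB a (DeltaEtaSlot F n K c₀) U₀ (toL2 F K c₀ X))) b‖ ≤ cV * Real.exp (-(κ * (Site.tdist (P := F.P K) (iterBlockOf (K - n) b.src) z : ℝ))))
    (hLoc : ∀ b : PBond (F.P K) 0, ‖(eta F n K)⁻¹ • (eta F n K)⁻¹ •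
        (deltaPrimeOp (torusT (F.P K) 0) (fun μ x => bgUnits F K U₀ ⟨x, μ⟩) 1 (formComp ((toL2 F K c₀).symm (GT F n K h c₀ cB a (DeltaEtaSlot F n K c₀) U₀ (toL2 F K c₀ X)))) b.dir b.src
          - curvOp (torusT (F.P K) 0) (fun μ x => bgUnits F K U₀ ⟨x, μ⟩) (formComp ((toL2 F K c₀).symm (GT F n K h c₀ cB a (DeltaEtaSlot F n K c₀) U₀ (toL2 F K c₀ X)))) b.dir b.src)‖ ≤ cL * Real.exp (-(κ * (Site.tdist (P := F.P K) (iterBlockOf (K - n) b.src) z : ℝ))))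
    (hDw : ∀ b : PBond (F.P K) 0, ‖(toL2 F K c₀).symm (DL2 F n K c₀ U₀ (DstarL2 F n K c₀ U₀ (toL2 F K c₀ ((toL2 F K c₀).symm (GT F n K h c₀ cB a (DeltaEtaSlot F n K c₀) U₀ (toL2 F K c₀ X)))) - RS F n K h c₀ cB U₀ (DstarL2 F n K c₀ U₀ (toL2 F K c₀ ((toL2 F K c₀).symm (GT F n K h c₀ cB a (DeltaEtaSlot F n K c₀) U₀ (toL2 F K c₀ X))))))) b‖ ≤ cD * Real.exp (-(κ * (Site.tdist (P := F.P K) (iterBlockOf (K - n) b.src) z : ℝ))))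
    (hQw : ∀ b : PBond (F.P K) 0, ‖(toL2 F K c₀).symm (LinearMap.adjoint (Qk F n K h c₀ cB U₀) (((a : ℝ) : ℂ) • Qk F n K h c₀ cB U₀ (toL2 F K c₀ ((toL2 F K c₀).symm (GT F n K h c₀ cB a (DeltaEtaSlot F n K c₀) U₀ (toL2 F K c₀ X)))))) b‖ ≤ cQ * Real.exp (-(κ * (Site.tdist (P := F.P K) (iterBlockOf (K - n) b.src) z : ℝ))))
    (hSrc : ∀ b : PBond (F.P K) 0, ‖X b‖ ≤ cS * Real.exp (-(κ * (Site.tdist (P := F.P K) (iterBlockOf (K - n) b.src) z : ℝ))))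
    (hroom : 2 * (12 * F.L ^ (K - n) + 5) ≤ (F.P K).sitesPerDir 0)
    (hsmall : exists_curved_localGradient.choose * ((48 * ε₀) * (6 * Real.sqrt 2 * Real.sqrt 10 + 6 * Real.sqrt 2)) * Real.exp (51 * κ) ≤ 1 / 2)
    (ν : Fin (F.P K).d) (b : PBond (F.P K) 0) :
    ‖(toL2 F K c₀).symm (DL2 F n K c₀ U₀ (toL2S F K c₀ (formComp ((toL2 F K c₀).symm (GT F n K h c₀ cB a (DeltaEtaSlot F n K c₀) U₀ (toL2 F K c₀ X))) ν))) b‖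
      ≤ (2 * ((exists_curved_localGradient.choose * (((Real.sqrt 2 * cV) * Real.exp (51 * κ)) * (2 + 2 * Real.sqrt 2 * (4 * ε₀ * (3 + 2457 * norm_bgOfCfg_axialT_sub_le.choose)) + (24 * Real.sqrt 10 + 48) * (48 * ε₀) ^ 2) + (Real.sqrt 2 * (cL + cD + cQ + cS)) * Real.exp (51 * κ)) + 2 * Real.sqrt 2 * (48 * ε₀) * ((Real.sqrt 2 * cV) * Real.exp (51 * κ))))) * Real.exp (-(κ * (Site.tdist (P := F.P K) (iterBlockOf (K - n) b.src) z : ℝ))) := by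
  have hXY : laplaceA F n K h c₀ cB a (DeltaEtaSlot F n K c₀) U₀ (toL2 F K c₀ ((toL2 F K c₀).symm (GT F n K h c₀ cB a (DeltaEtaSlot F n K c₀) U₀ (toL2 F K c₀ X)))) = toL2 F K c₀ X := by
    rw [LinearEquiv.apply_symm_apply]; exact laplaceA_GT hp _
  exact Prop7PoissonGradientDecay.gradient_decay_of_decay' F n K hε₀ hε₀1 U₀ hreg c₀ _ _
    (Prop7OneFormGradientSup.covLapSite_formComp_add_eq F h c₀ cB a (DeltaEtaSlot F n K c₀) U₀ _ X hXY ν) z hκ (by positivity) (by positivity)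
    (formComp_decay_of_val F c₀ _ z κ hval ν) (remainder_decay_of_rows F c₀ U₀ _ X z κ hLoc hDw hQw hSrc ν) hroom hsmall b


/-! ## §2 ★★★ The letter (dκ) -/

/-- ★★★ **(dκ) «N5-blk»: THE DECAYED COVARIANT-DIVERGENCE ROW OF `G₀` ON A BLOCK-SUPPORTED SOURCE** ([Balaban1985BackgroundPropagators] Thm 3.1 (3.42)₂∕(3.43) for the member's `G₀` at
the slot of record, divergence∕decay edition).  DISPLAYED: `RegPr F n K ε₀ U₀` with `0 < ε₀ ≤ 1`; `PosOnto` at `Δx := DeltaEtaSlot`; the one-form Agmon letters (γ) `hco`, (C_V) `hVlow`,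
(θ_V-class) `hVconj`, the window `0 < Θ` (`Θ = (1−ε)γ − εC_V − 3r²e^{2r}(1+1∕ε) − θ_V`); the kernel rows `hkD` (`D(1−R_S)D*`, the EX row `h349`'s member text) and `hkQ` (`Q_k†(a•Q_k)`) at a rate
`μ′ > r`; THE DECAYED VALUE ROW `hval` (`‖toL2⁻¹(G₀(toL2 X)) b‖ ≤ s·A_V·e^{−κ₁·d(B b₋, z)}`, `κ₁ := min r (1∕4)∕2` — px16 ✓`Prop7OneFormGreenSupBound.norm_symm_GT_apply_le_of_blockSupport`'s
CONCLUSION, its constant a free real letter `A_V` — no sign displayed, `0 ≤ s·A_V` is read off the row itself); the no-wrap room `2(12ℓ+5) ≤ sitesPerDir`; and the gradient margin `C_g·(48ε₀(6√2√10 + 6√2))·e^{51κ₁} ≤ ½`.  THEN for every bond field `X` supported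
on the bonds of the block `z` with `‖X b‖ ≤ s` and every site `x`:
`‖(toL2S⁻¹(D*_{U₀}(G₀(toL2 X))))(x)‖ ≤ s·C_D·e^{−κ₁·tdist(B x, z)}`, `C_D = 3·e^{4κ₁}·M`, `M = 2·(C_g·(√2A_V e^{51κ₁}·c(ε₀) + √2A_q·e^{51κ₁}) + 2√2·48ε₀·√2A_V e^{51κ₁})`,
`A_q = 32ε₀·A_V e^{5κ₁} + (C_kD + C_kQ)·√(dℓ^d∕c₀)·D₁·(2(1+1∕(μ′−r)))³ + 1` (as a sum of the two words), `D₁ = e^{6r}√(2c₀dℓ^d)∕Θ`.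
PROOF = §1 with the rows: VALUE `hval`; local pair part 2 ✓`norm_local_pair_le_of_decay` (`32ε₀·sA_V·e^{5κ₁}`); (D)∕(Q) words part 2 ✓`norm_word_le_of_kernelRow_blockDecay` at rate `r ≥ κ₁` over
✓`blockL2Decay_GT_of_letters`; source by support (✓`norm_le_mul_exp_neg_of_support`); then part 2 ✓`norm_symm_DstarL2_le_of_componentDecay`.
K-BOOKKEEPING (for the knitter's numerics, cf. px16's `…OneFormGreenKFreeNumerics`): every `(L^d)^{K−n}` above stands next to `C_kD`, `C_kQ` (`ℓ⁻³`-class, chair №13) or inside `√(2c₀dℓ^d)`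
(`= √6` at the pin `c₀ = ℓ⁻³`).  CONDITIONAL on every displayed letter; nothing of FILE D, `norm_G`, `h133`, the EX rows, EX or the crux is proved here.
[cite: Balaban1985BackgroundPropagators, (3.8) p.392, Thm 3.1 (3.42)–(3.44) pp.397–398, (3.46) p.398, (3.49) p.399, Thm 3.12 p.422; Balaban1985Variational, (19) p.281, (134)–(135) p.298] -/
theorem norm_symm_DstarL2_GT_le_of_blockSupport (hnK : n ≤ K) {ε₀ : ℝ} (hε₀ : 0 < ε₀) (hε₀1 : ε₀ ≤ 1) (hreg : RegPr F n K ε₀ U₀)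
    (hp : PosOnto F n K h c₀ cB a (DeltaEtaSlot F n K c₀) U₀)
    {r : ℝ} (hr : 0 < r) {γ CV θV ε : ℝ} (hε : 0 < ε) (hε1 : ε ≤ 1)
    (hco : ∀ v : BondL2K ℂ 3 (periodsT3 F K) c₀ W₂, γ * ‖v‖ ^ 2 ≤ RCLike.re ⟪v, laplaceA F n K h c₀ cB a (DeltaEtaSlot F n K c₀) U₀ v⟫_ℂ)
    (hVlow : ∀ X : PBond (F.P K) 0 → Matrix (Fin 2) (Fin 2) ℂ,
      -(CV * ‖toL2 F K c₀ X‖ ^ 2) ≤ RCLike.re ⟪toL2 F K c₀ X, laplaceA F n K h c₀ cB a (DeltaEtaSlot F n K c₀) U₀ (toL2 F K c₀ X)⟫_ℂ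
        - ∑ μ : Fin (F.P K).d, ‖DL2 F n K c₀ U₀ (toL2S F K c₀ (formComp X μ))‖ ^ 2)
    (hVconj : ∀ φ : Site (F.P K) 0 → ℝ, (∀ x x' : Site (F.P K) 0, |φ x - φ x'| ≤ r * eta F n K * (Site.tdist x x' : ℝ)) →
      ∀ X : PBond (F.P K) 0 → Matrix (Fin 2) (Fin 2) ℂ,
      RCLike.re ⟪toL2 F K c₀ X, laplaceA F n K h c₀ cB a (DeltaEtaSlot F n K c₀) U₀ (toL2 F K c₀ X)⟫_ℂ
          - (∑ μ : Fin (F.P K).d, ‖DL2 F n K c₀ U₀ (toL2S F K c₀ (formComp X μ))‖ ^ 2) - θV * ‖toL2 F K c₀ X‖ ^ 2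
        ≤ RCLike.re ⟪toL2 F K c₀ (fun b => Real.exp (φ b.src) • X b), laplaceA F n K h c₀ cB a (DeltaEtaSlot F n K c₀) U₀ (toL2 F K c₀ (fun b => (Real.exp (φ b.src))⁻¹ • X b))⟫_ℂ
          - RCLike.re (∑ μ : Fin (F.P K).d, ⟪DL2 F n K c₀ U₀ (toL2S F K c₀ (formComp (fun b => Real.exp (φ b.src) • X b) μ)),
              DL2 F n K c₀ U₀ (toL2S F K c₀ (formComp (fun b => (Real.exp (φ b.src))⁻¹ • X b) μ))⟫_ℂ))
    (hΘ : 0 < ((1 - ε) * γ - ε * CV - 3 * (r ^ 2 * Real.exp (2 * r)) * (1 + 1 / ε) - θV))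
    {CkD CkQ μ' : ℝ} (hCkD : 0 ≤ CkD) (hCkQ : 0 ≤ CkQ) (hrμ : r < μ')
    (hkD : ∀ (b : PBond (F.P K) 0) (Z : Matrix (Fin 2) (Fin 2) ℂ) (bd : PBond (F.P K) 0),
      ‖(toL2 F K c₀).symm (DL2 F n K c₀ U₀ (DstarL2 F n K c₀ U₀ (toL2 F K c₀ (Pi.single b Z))
          - RS F n K h c₀ cB U₀ (DstarL2 F n K c₀ U₀ (toL2 F K c₀ (Pi.single b Z))))) bd‖
        ≤ CkD * Real.exp (-(μ' * (Site.tdist (P := F.P K) (iterBlockOf (K - n) b.src) (iterBlockOf (K - n) bd.src) : ℝ))) * ‖Z‖)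
    (hkQ : ∀ (b : PBond (F.P K) 0) (Z : Matrix (Fin 2) (Fin 2) ℂ) (bd : PBond (F.P K) 0),
      ‖(toL2 F K c₀).symm (LinearMap.adjoint (Qk F n K h c₀ cB U₀) (((a : ℝ) : ℂ) • Qk F n K h c₀ cB U₀ (toL2 F K c₀ (Pi.single b Z)))) bd‖
        ≤ CkQ * Real.exp (-(μ' * (Site.tdist (P := F.P K) (iterBlockOf (K - n) b.src) (iterBlockOf (K - n) bd.src) : ℝ))) * ‖Z‖)
    (X : PBond (F.P K) 0 → Matrix (Fin 2) (Fin 2) ℂ) (z : Site (F.P K) (K - n)) (hXz : ∀ b, X b ≠ 0 → iterBlockOf (K - n) b.src = z)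
    {s : ℝ} (hs : 0 ≤ s) (hX : ∀ b, ‖X b‖ ≤ s)
    {AV : ℝ}
    (hval : ∀ bd : PBond (F.P K) 0, ‖((toL2 F K c₀).symm (GT F n K h c₀ cB a (DeltaEtaSlot F n K c₀) U₀ (toL2 F K c₀ X))) bd‖ ≤ s * AV * Real.exp (-((min r (1 / 4) / 2) * (Site.tdist (P := F.P K) (iterBlockOf (K - n) bd.src) z : ℝ))))
    (hroom : 2 * (12 * F.L ^ (K - n) + 5) ≤ (F.P K).sitesPerDir 0)
    (hsmall : exists_curved_localGradient.choose * ((48 * ε₀) * (6 * Real.sqrt 2 * Real.sqrt 10 + 6 * Real.sqrt 2)) * Real.exp (51 * (min r (1 / 4) / 2)) ≤ 1 / 2)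
    (x : Site (F.P K) 0) :
    ‖(toL2S F K c₀).symm (DstarL2 F n K c₀ U₀ (GT F n K h c₀ cB a (DeltaEtaSlot F n K c₀) U₀ (toL2 F K c₀ X))) x‖
      ≤ s * (3 * (Real.exp (4 * (min r (1 / 4) / 2)) * (2 * ((exists_curved_localGradient.choose * (((Real.sqrt 2 * AV) * Real.exp (51 * (min r (1 / 4) / 2))) * (2 + 2 * Real.sqrt 2 * (4 * ε₀ * (3 + 2457 * norm_bgOfCfg_axialT_sub_le.choose)) + (24 * Real.sqrt 10 + 48) * (48 * ε₀) ^ 2) + (Real.sqrt 2 * ((32 * ε₀ * (AV * Real.exp (5 * (min r (1 / 4) / 2)))) + (CkD * Real.sqrt ((((F.P K).d : ℝ) * ((((F.P K).L : ℝ) ^ (F.P K).d) ^ (K - n))) / c₀) * (Real.exp (6 * r) * Real.sqrt (2 * c₀ * (((F.P K).d : ℝ) * ((((F.P K).L : ℝ) ^ (F.P K).d) ^ (K - n)))) / ((1 - ε) * γ - ε * CV - 3 * (r ^ 2 * Real.exp (2 * r)) * (1 + 1 / ε) - θV)) * (2 * (1 + 1 / (μ' - r))) ^ 3) + (CkQ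 * Real.sqrt ((((F.P K).d : ℝ) * ((((F.P K).L : ℝ) ^ (F.P K).d) ^ (K - n))) / c₀) * (Real.exp (6 * r) * Real.sqrt (2 * c₀ * (((F.P K).d : ℝ) * ((((F.P K).L : ℝ) ^ (F.P K).d) ^ (K - n)))) / ((1 - ε) * γ - ε * CV - 3 * (r ^ 2 * Real.exp (2 * r)) * (1 + 1 / ε) - θV)) * (2 * (1 + 1 / (μ' - r))) ^ 3) + 1)) * Real.exp (51 * (min r (1 / 4) / 2))) + 2 * Real.sqrt 2 * (48 * ε₀) * ((Real.sqrt 2 * AV) * Real.exp (51 * (min r (1 / 4) / 2)))))))) * Real.exp (-((min r (1 / 4) / 2) * (Site.tdist (P := F.P K) (iterBlockOf (K - n) x) z : ℝ))) := by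
  have hc₀ : 0 < c₀ := Fact.out
  have hk1 : 0 < (min r (1 / 4) / 2) := by have := lt_min hr (by norm_num : (0 : ℝ) < 1 / 4); positivity
  have hk1r : (min r (1 / 4) / 2) ≤ r := by have := min_le_left r (1 / 4); linarith
  have hD₁0 : 0 ≤ (Real.exp (6 * r) * Real.sqrt (2 * c₀ * (((F.P K).d : ℝ) * ((((F.P K).L : ℝ) ^ (F.P K).d) ^ (K - n)))) / ((1 - ε) * γ - ε * CV - 3 * (r ^ 2 * Real.exp (2 * r)) * (1 + 1 / ε) - θV)) := div_nonneg (by positivity) hΘ.le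
  have hS0 : 0 ≤ (2 * (1 + 1 / (μ' - r))) ^ 3 := by
    have : 0 < μ' - r := by linarith
    positivity
  -- rate `r` rows read at rate `κ₁ ≤ r`
  have hEr : ∀ b : PBond (F.P K) 0, Real.exp (-(r * (Site.tdist (P := F.P K) (iterBlockOf (K - n) b.src) z : ℝ))) ≤ Real.exp (-((min r (1 / 4) / 2) * (Site.tdist (P := F.P K) (iterBlockOf (K - n) b.src) z : ℝ))) := fun b =>
    Real.exp_le_exp.2 (by nlinarith [Nat.cast_nonneg (α := ℝ) (Site.tdist (P := F.P K) (iterBlockOf (K - n) b.src) z)])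
  -- VALUE
  have hWd : ∀ b : PBond (F.P K) 0, ‖((toL2 F K c₀).symm (GT F n K h c₀ cB a (DeltaEtaSlot F n K c₀) U₀ (toL2 F K c₀ X))) b‖ ≤ (s * AV) * Real.exp (-((min r (1 / 4) / 2) * (Site.tdist (P := F.P K) (iterBlockOf (K - n) b.src) z : ℝ))) := fun b => hval b
  -- `0 ≤ s·A_V` is READ OFF the value row at one bond (no sign hypothesis on `A_V` displayed)
  have hsAV : 0 ≤ s * AV := by
    have hb := hval ⟨x, ⟨0, by rw [T3Family.P_d]; norm_num⟩⟩
    have hE : 0 < Real.exp (-((min r (1 / 4) / 2) * (Site.tdist (P := F.P K) (iterBlockOf (K - n) (⟨x, ⟨0, by rw [T3Family.P_d]; norm_num⟩⟩ : PBond (F.P K) 0).src) z : ℝ))) :=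
      Real.exp_pos _
    have h0 : 0 * Real.exp (-((min r (1 / 4) / 2) * (Site.tdist (P := F.P K) (iterBlockOf (K - n) (⟨x, ⟨0, by rw [T3Family.P_d]; norm_num⟩⟩ : PBond (F.P K) 0).src) z : ℝ)))
        ≤ (s * AV) * Real.exp (-((min r (1 / 4) / 2) * (Site.tdist (P := F.P K) (iterBlockOf (K - n) (⟨x, ⟨0, by rw [T3Family.P_d]; norm_num⟩⟩ : PBond (F.P K) 0).src) z : ℝ))) := by
      rw [zero_mul]; exact (norm_nonneg _).trans hb
    exact le_of_mul_le_mul_right h0 hE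
  have hWeq : toL2 F K c₀ ((toL2 F K c₀).symm (GT F n K h c₀ cB a (DeltaEtaSlot F n K c₀) U₀ (toL2 F K c₀ X))) = GT F n K h c₀ cB a (DeltaEtaSlot F n K c₀) U₀ (toL2 F K c₀ X) := LinearEquiv.apply_symm_apply _ _
  -- the block-`L²` decay and the two words
  have hD := blockL2Decay_GT_of_letters F c₀ U₀ hnK hp hr hε hε1 hco hVlow hVconj hΘ X z hXz hs hX
  have hkD' : ∀ (b : PBond (F.P K) 0) (Z : Matrix (Fin 2) (Fin 2) ℂ) (bd : PBond (F.P K) 0),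
      ‖(toL2 F K c₀).symm ((DL2 F n K c₀ U₀ ∘ₗ (DstarL2 F n K c₀ U₀ - RS F n K h c₀ cB U₀ ∘ₗ DstarL2 F n K c₀ U₀)) (toL2 F K c₀ (Pi.single b Z))) bd‖
        ≤ CkD * Real.exp (-(μ' * (Site.tdist (P := F.P K) (iterBlockOf (K - n) b.src) (iterBlockOf (K - n) bd.src) : ℝ))) * ‖Z‖ := fun b Z bd => hkD b Z bd
  have hkQ' : ∀ (b : PBond (F.P K) 0) (Z : Matrix (Fin 2) (Fin 2) ℂ) (bd : PBond (F.P K) 0),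
      ‖(toL2 F K c₀).symm ((LinearMap.adjoint (Qk F n K h c₀ cB U₀) ∘ₗ (((a : ℝ) : ℂ) • Qk F n K h c₀ cB U₀)) (toL2 F K c₀ (Pi.single b Z))) bd‖
        ≤ CkQ * Real.exp (-(μ' * (Site.tdist (P := F.P K) (iterBlockOf (K - n) b.src) (iterBlockOf (K - n) bd.src) : ℝ))) * ‖Z‖ := fun b Z bd => hkQ b Z bd
  have hDword : ∀ bd : PBond (F.P K) 0, ‖(toL2 F K c₀).symm (DL2 F n K c₀ U₀ (DstarL2 F n K c₀ U₀ (toL2 F K c₀ ((toL2 F K c₀).symm (GT F n K h c₀ cB a (DeltaEtaSlot F n K c₀) U₀ (toL2 F K c₀ X)))) - RS F n K h c₀ cB U₀ (DstarL2 F n K c₀ U₀ (toL2 F K c₀ ((toL2 F K c₀).symm (GT F n K h c₀ cB a (DeltaEtaSlot F n K c₀) U₀ (toL2 F K c₀ X))))))) bd‖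
      ≤ (CkD * Real.sqrt ((((F.P K).d : ℝ) * ((((F.P K).L : ℝ) ^ (F.P K).d) ^ (K - n))) / c₀) * ((Real.exp (6 * r) * Real.sqrt (2 * c₀ * (((F.P K).d : ℝ) * ((((F.P K).L : ℝ) ^ (F.P K).d) ^ (K - n)))) / ((1 - ε) * γ - ε * CV - 3 * (r ^ 2 * Real.exp (2 * r)) * (1 + 1 / ε) - θV)) * s) * (2 * (1 + 1 / (μ' - r))) ^ 3) * Real.exp (-((min r (1 / 4) / 2) * (Site.tdist (P := F.P K) (iterBlockOf (K - n) bd.src) z : ℝ))) := by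
    intro bd
    have h1 := norm_word_le_of_kernelRow_blockDecay F c₀ _ hCkD hkD' _ z (mul_nonneg hD₁0 hs) hr.le hrμ hD bd
    rw [hWeq]
    exact h1.trans (mul_le_mul_of_nonneg_left (hEr bd) (mul_nonneg (mul_nonneg (mul_nonneg hCkD (Real.sqrt_nonneg _)) (mul_nonneg hD₁0 hs)) hS0))
  have hQword : ∀ bd : PBond (F.P K) 0, ‖(toL2 F K c₀).symm (LinearMap.adjoint (Qk F n K h c₀ cB U₀) (((a : ℝ) : ℂ) • Qk F n K h c₀ cB U₀ (toL2 F K c₀ ((toL2 F K c₀).symm (GT F n K h c₀ cB a (DeltaEtaSlot F n K c₀) U₀ (toL2 F K c₀ X)))))) bd‖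
      ≤ (CkQ * Real.sqrt ((((F.P K).d : ℝ) * ((((F.P K).L : ℝ) ^ (F.P K).d) ^ (K - n))) / c₀) * ((Real.exp (6 * r) * Real.sqrt (2 * c₀ * (((F.P K).d : ℝ) * ((((F.P K).L : ℝ) ^ (F.P K).d) ^ (K - n)))) / ((1 - ε) * γ - ε * CV - 3 * (r ^ 2 * Real.exp (2 * r)) * (1 + 1 / ε) - θV)) * s) * (2 * (1 + 1 / (μ' - r))) ^ 3) * Real.exp (-((min r (1 / 4) / 2) * (Site.tdist (P := F.P K) (iterBlockOf (K - n) bd.src) z : ℝ))) := by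
    intro bd
    have h1 := norm_word_le_of_kernelRow_blockDecay F c₀ _ hCkQ hkQ' _ z (mul_nonneg hD₁0 hs) hr.le hrμ hD bd
    rw [hWeq]
    exact h1.trans (mul_le_mul_of_nonneg_left (hEr bd) (mul_nonneg (mul_nonneg (mul_nonneg hCkQ (Real.sqrt_nonneg _)) (mul_nonneg hD₁0 hs)) hS0))
  -- LOCAL pair and SOURCE
  have hLoc := norm_local_pair_le_of_decay F U₀ hreg ((toL2 F K c₀).symm (GT F n K h c₀ cB a (DeltaEtaSlot F n K c₀) U₀ (toL2 F K c₀ X))) z hk1.le hsAV hWd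
  have hSrc : ∀ b : PBond (F.P K) 0, ‖X b‖ ≤ s * Real.exp (-((min r (1 / 4) / 2) * (Site.tdist (P := F.P K) (iterBlockOf (K - n) b.src) z : ℝ))) := fun b =>
    norm_le_mul_exp_neg_of_support X (fun b => (Site.tdist (P := F.P K) (iterBlockOf (K - n) b.src) z : ℝ)) (min r (1 / 4) / 2) hX
      (fun b hb => by rw [hXz b hb]; exact_mod_cast B3Taylor310LocalRemainder.tdist_self z) b
  -- the components' gradients, then the divergence
  have hgrad := componentGradient_decay_of_rows F c₀ U₀ (h := h) (cB := cB) (a := a) hε₀ hε₀1 hreg hp X z hk1.le hsAV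
    (mul_nonneg (by positivity) (mul_nonneg hsAV (Real.exp_pos _).le) : 0 ≤ 32 * ε₀ * ((s * AV) * Real.exp (5 * (min r (1 / 4) / 2))))
    (mul_nonneg (mul_nonneg (mul_nonneg hCkD (Real.sqrt_nonneg _)) (mul_nonneg hD₁0 hs)) hS0)
    (mul_nonneg (mul_nonneg (mul_nonneg hCkQ (Real.sqrt_nonneg _)) (mul_nonneg hD₁0 hs)) hS0) hs
    hWd (fun b => (hLoc b).trans_eq (by ring)) hDword hQword hSrc hroom hsmall
  have hM0 : 0 ≤ (2 * ((exists_curved_localGradient.choose * (((Real.sqrt 2 * (s * AV)) * Real.exp (51 * (min r (1 / 4) / 2))) * (2 + 2 * Real.sqrt 2 * (4 * ε₀ * (3 + 2457 * norm_bgOfCfg_axialT_sub_le.choose)) + (24 * Real.sqrt 10 + 48) * (48 * ε₀) ^ 2) + (Real.sqrt 2 * ((32 * ε₀ * ((s * AV) * Real.exp (5 * (min r (1 / 4) / 2)))) + (CkD * Real.sqrt ((((F.P K).d : ℝ) * ((((F.P K).L : ℝ) ^ (F.P K).d) ^ (K - n))) / c₀) * ((Real.exp (6 * r) * Real.sqrt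 (2 * c₀ * (((F.P K).d : ℝ) * ((((F.P K).L : ℝ) ^ (F.P K).d) ^ (K - n)))) / ((1 - ε) * γ - ε * CV - 3 * (r ^ 2 * Real.exp (2 * r)) * (1 + 1 / ε) - θV)) * s) * (2 * (1 + 1 / (μ' - r))) ^ 3) + (CkQ * Real.sqrt ((((F.P K).d : ℝ) * ((((F.P K).L : ℝ) ^ (F.P K).d) ^ (K - n))) / c₀) * ((Real.exp (6 * r) * Real.sqrt (2 * c₀ * (((F.P K).d : ℝ) * ((((F.P K).L : ℝ) ^ (F.P K).d) ^ (K - n)))) / ((1 - ε) * γ - ε * CV - 3 * (r ^ 2 * Real.exp (2 * r)) * (1 + 1 / ε) - θV)) * s) * (2 * (1 + 1 / (μ' - r))) ^ 3) + s)) * Real.exp (51 * (min r (1 / 4) / 2))) + 2 * Real.sqrt 2 * (48 * ε₀) * ((Real.sqrt 2 * (s * AV)) * Real.exp (51 * (min r (1 / 4) / 2)))))) := by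
    have hCg := exists_curved_localGradient.choose_spec.1
    have hC := norm_bgOfCfg_axialT_sub_le.choose_spec.1
    have h1 : 0 ≤ ((32 * ε₀ * ((s * AV) * Real.exp (5 * (min r (1 / 4) / 2)))) + (CkD * Real.sqrt ((((F.P K).d : ℝ) * ((((F.P K).L : ℝ) ^ (F.P K).d) ^ (K - n))) / c₀) * ((Real.exp (6 * r) * Real.sqrt (2 * c₀ * (((F.P K).d : ℝ) * ((((F.P K).L : ℝ) ^ (F.P K).d) ^ (K - n)))) / ((1 - ε) * γ - ε * CV - 3 * (r ^ 2 * Real.exp (2 * r)) * (1 + 1 / ε) - θV)) * s) * (2 * (1 + 1 / (μ' - r))) ^ 3) + (CkQ * Real.sqrt ((((F.P K).d : ℝ) * ((((F.P K).L : ℝ) ^ (F.P K).d) ^ (K - n))) / c₀) * ((Real.exp (6 * r) * Real.sqrt (2 * c₀ * (((F.P K).d : ℝ) * ((((F.P K).L : ℝ) ^ (F.P K).d) ^ (K - n)))) / ((1 - ε) * γ - ε * CV - 3 * (r ^ 2 * Real.exp (2 * r)) * (1 + 1 / ε) - θV)) * s) * (2 * (1 + 1 / (μ' - r))) ^ 3)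 + s) := by
      refine add_nonneg (add_nonneg (add_nonneg (mul_nonneg (by positivity) (mul_nonneg hsAV (Real.exp_pos _).le)) ?_) ?_) hs
      · exact mul_nonneg (mul_nonneg (mul_nonneg hCkD (Real.sqrt_nonneg _)) (mul_nonneg hD₁0 hs)) hS0
      · exact mul_nonneg (mul_nonneg (mul_nonneg hCkQ (Real.sqrt_nonneg _)) (mul_nonneg hD₁0 hs)) hS0
    have hcε : 0 ≤ (2 + 2 * Real.sqrt 2 * (4 * ε₀ * (3 + 2457 * norm_bgOfCfg_axialT_sub_le.choose)) + (24 * Real.sqrt 10 + 48) * (48 * ε₀) ^ 2) := by positivity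
    have hA : 0 ≤ (Real.sqrt 2 * (s * AV)) * Real.exp (51 * (min r (1 / 4) / 2)) := mul_nonneg (mul_nonneg (Real.sqrt_nonneg _) hsAV) (Real.exp_pos _).le
    exact mul_nonneg (by norm_num) (add_nonneg (mul_nonneg hCg (add_nonneg (mul_nonneg hA hcε) (mul_nonneg (mul_nonneg (Real.sqrt_nonneg _) h1) (Real.exp_pos _).le)))
      (mul_nonneg (by positivity) hA))
  have hfin := norm_symm_DstarL2_le_of_componentDecay F c₀ U₀ ((toL2 F K c₀).symm (GT F n K h c₀ cB a (DeltaEtaSlot F n K c₀) U₀ (toL2 F K c₀ X))) z hk1.le hM0 hgrad x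
  rw [hWeq] at hfin
  refine hfin.trans (le_of_eq ?_)
  ring

end Summit.QuantumFields.YangMills.Theorems.Prop7OneFormGreenBlockDivergence

end
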